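import Summits.CriticalPhenomena.CardyFormulaZ2.Theorems.CardySusyWardDiscretisationFamilyExistsDefs
import Summits.CriticalPhenomena.CardyFormulaZ2.Theorems.CardySusyWardDiscretisationFamilyExistsExitArc
import Summits.CriticalPhenomena.CardyFormulaZ2.Theorems.CardySusyWardDiscretisationFamilyExistsLegLocal
import Summits.CriticalPhenomena.CardyFormulaZ2.Theorems.CardySusyWardDiscretisationFamilyExistsColumns
import HarnessLib

/-!
# The leg of shape C1 (straight crossing) — helper for `DiscretisationFamilyExists` (stmt-CriticalPhenomena-9644)

Standard orientation, coordinates of `Mesh.cell`, bare data `⟨Ω, δ, ∅, ∅⟩` on a regular open set.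
From a straight-crossing datum — column `k` clean on rows `y' … R` (`y' < R`), the cell
`(k, y'-1)` not inner, the bottom edge `[(k, y'), (k+1, y')]` non-degenerate — `legData_C1`
builds the `LegData` of the leg: plug `P` = the exit arc from the centre `C` of `(k, y')` through
the midpoint `P*` of the bottom edge into `(k, y'-1)` (`exists_exitArc`), run = the vertical segment
from `C` to the centre of `(k, R)`, cut edge `u = (k, y')`, `v = (k+1, y')` (`mv = 0`), sector
point `z₀ = (δ(k+½), δ(y'+¼))` with `ε = δ/8`.  All fields are read off the coordinates: the run
and `segment C P*` have `re = δ(k+½)`, the rest of the plug lies in the open cell `(k, y'-1)` or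
is the landing point `c ∉ Ω`.
-/

noncomputable section

open Set Metric Complex
open Literature.Probability.LatticeModels Literature.Probability.Percolation
  Literature.Probability.LatticeModels.Mesh Literature.Probability.LatticeModels.DiscreteDobrushin
  Literature.Topology.PlaneTopology

namespace Summit.CriticalPhenomena.CardyFormulaZ2.Theorems.DiscretisationFamilyExists

/-! ### The leg -/

set_option maxHeartbeats 400000 in
/-- **The `LegData` of a straight crossing.** See the module docstring. The window hypothesis asks
that the box `re ∈ [δ(k-4), δ(k+5)]`, `im ∈ [δ(y'-2), δ(R+2)]` lie in `ball a η`; the deep point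
`p` is within `2δ` of the centre of `(k, R)`. [folklore] -/
theorem legData_C1 {Ω : Set ℂ} {δ : ℝ} (hΩ : IsOpen Ω)
    (hJE : frontier Ω ⊆ closure (closure Ω)ᶜ) (hext : IsConnected (closure Ω)ᶜ)
    (hunb : ¬ Bornology.IsBounded (closure Ω)ᶜ) (hδ : 0 < δ) {k y' R : ℤ} (hy'R : y' < R)
    (hcol : ∀ j : ℤ, y' ≤ j → j ≤ R → (⟨Ω, δ, ∅, ∅⟩ : DiscreteDobrushin).IsInnerFace ![k, j] ∧
      ¬ (((![k, j + 1] : Site 2) ∈ (⟨Ω, δ, ∅, ∅⟩ : DiscreteDobrushin).zdBoundary) ∧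
        ((![k + 1, j + 1] : Site 2) ∈ (⟨Ω, δ, ∅, ∅⟩ : DiscreteDobrushin).zdBoundary)))
    (hQ' : ¬ (⟨Ω, δ, ∅, ∅⟩ : DiscreteDobrushin).IsInnerFace ![k, y' - 1])
    (hnd : ¬ (δ + infDist (meshPoint δ ![k, y']) (frontier Ω) ≤ infDist (meshPoint δ ![k + 1, y']) (frontier Ω)) ∧
      ¬ (δ + infDist (meshPoint δ ![k + 1, y']) (frontier Ω) ≤ infDist (meshPoint δ ![k, y']) (frontier Ω)))
    {a p : ℂ} {η : ℝ} (hp : dist (cellCenter δ k R) p ≤ 2 * δ)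
    (hwin : ∀ z : ℂ, δ * (k - 4) ≤ z.re → z.re ≤ δ * (k + 5) → δ * (y' - 2) ≤ z.im → z.im ≤ δ * (R + 2) →
      z ∈ ball a η) :
    Nonempty (LegData Ω δ a η p) := by
  have hQ : (⟨Ω, δ, ∅, ∅⟩ : DiscreteDobrushin).IsInnerFace ![k, y'] := (hcol y' le_rfl hy'R.le).1
  obtain ⟨huB, hvB⟩ := mem_zdBoundary_of_inner_not_inner_below hQ hQ'
  have hadj : (k = k ∧ (y' - 1 = y' + 1 ∨ y' - 1 = y' - 1)) ∨ (y' - 1 = y' ∧ (k = k + 1 ∨ k = k - 1)) :=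
    Or.inl ⟨rfl, Or.inr rfl⟩
  obtain ⟨c, hc_fr, X, hXarc, hXΩ, hsegX, hXsub, hcF', hXmem, hc_cases⟩ :=
    exists_exitArc (E := (⟨Ω, δ, ∅, ∅⟩ : DiscreteDobrushin)) hΩ hJE hext hunb hδ hQ hQ' hadj
  -- coordinates
  set C := cellCenter δ k y' with hC
  set C' := cellCenter δ k (y' - 1) with hC'
  set Pstar := (2⁻¹ : ℝ) • (C + C') with hP
  set ztop := cellCenter δ k R with hztop
  set z₀ : ℂ := ⟨δ * k + δ / 2, δ * y' + δ / 4⟩ with hz₀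
  have hCeq : C = ⟨δ * (k + 1 / 2), δ * (y' + 1 / 2)⟩ := cellCenter_eq δ k y'
  have hC'eq : C' = ⟨δ * (k + 1 / 2), δ * (y' - 1 + 1 / 2)⟩ := by
    rw [hC', cellCenter_eq]; push_cast; rfl
  have hPeq : Pstar = ⟨δ * (k + 1 / 2), δ * y'⟩ := by
    rw [hP, hCeq, hC'eq]; apply Complex.ext <;> simp <;> ring
  have hueq : meshPoint δ ![k, y'] = ⟨δ * k, δ * y'⟩ := meshPoint_vec' δ k y'
  have hveq : meshPoint δ ![k + 1, y'] = ⟨δ * k + δ, δ * y'⟩ := by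
    rw [meshPoint_vec']; push_cast; apply Complex.ext <;> simp; ring
  have hyR' : (y' : ℝ) + 1 ≤ R := by exact_mod_cast hy'R
  have hwR1 : δ * (y' + 1 / 2) ≤ δ * (R + 2) := mul_le_mul_of_nonneg_left (by linarith) hδ.le
  have hwR2 : δ * y' ≤ δ * (R + 2) := mul_le_mul_of_nonneg_left (by linarith) hδ.le
  -- coordinates of the pieces
  have hrun : ∀ z ∈ segment ℝ C ztop, z.re = δ * (k + 1 / 2) ∧ δ * (y' + 1 / 2) ≤ z.im ∧ z.im ≤ δ * (R + 1 / 2) :=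
    fun z hz => re_im_of_mem_vertical_run hδ hy'R.le hz
  have hdown : ∀ z ∈ segment ℝ C C', z.re = δ * (k + 1 / 2) ∧ δ * (y' - 1 + 1 / 2) ≤ z.im ∧ z.im ≤ δ * (y' + 1 / 2) := by
    intro z hz
    rw [segment_symm] at hz
    have := re_im_of_mem_vertical_run hδ (by omega : y' - 1 ≤ y') hz
    push_cast at this
    exact this
  have hsegP_sub : segment ℝ C Pstar ⊆ segment ℝ C C' := by
    refine (convex_segment C C').segment_subset (left_mem_segment _ _ _) ?_
    rw [hP]; exact ⟨2⁻¹, 2⁻¹, by norm_num, by norm_num, by norm_num, by rw [smul_add]⟩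
  have hsegP : ∀ z ∈ segment ℝ C Pstar, z.re = δ * (k + 1 / 2) ∧ δ * y' ≤ z.im ∧ z.im ≤ δ * (y' + 1 / 2) := by
    intro z hz
    refine ⟨(hdown z (hsegP_sub hz)).1, ?_, (hdown z (hsegP_sub hz)).2.2⟩
    rw [segment_eq_image'] at hz
    obtain ⟨θ, ⟨h0, h1⟩, rfl⟩ := hz
    rw [hCeq, hPeq]; simp; linarith [mul_nonneg hδ.le h0, mul_nonneg hδ.le (sub_nonneg.2 h1)]
  have hcell' : ∀ z ∈ cell δ k (y' - 1), δ * k < z.re ∧ z.re < δ * (k + 1) ∧ δ * (y' - 1) < z.im ∧ z.im < δ * y' := by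
    intro z hz
    rw [mem_cell_iff] at hz; push_cast at hz
    exact ⟨hz.1.1, hz.1.2, hz.2.1, by linarith [hz.2.2]⟩
  have hcl' : ∀ z ∈ closure (cell δ k (y' - 1)), δ * k ≤ z.re ∧ z.re ≤ δ * (k + 1) ∧ δ * (y' - 1) ≤ z.im ∧ z.im ≤ δ * y' := by
    intro z hz
    rw [closure_cell hδ, mem_reProdIm] at hz; push_cast at hz
    exact ⟨hz.1.1, hz.1.2, hz.2.1, by linarith [hz.2.2]⟩
  -- points of the plug in `Ω`: on `segment C P*` or in the open cell below
  have hXΩmem : ∀ z ∈ X, z ∈ Ω → z ∈ segment ℝ C Pstar ∨ z ∈ cell δ k (y' - 1) := hXmem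
  -- the open cell `(k, y')` is in `Ω`
  have hfull : cell δ k y' ⊆ Ω := isFull_of_isInnerFace (E := (⟨Ω, δ, ∅, ∅⟩ : DiscreteDobrushin)) hΩ hJE hext hunb hδ hQ
  have huΩ : meshPoint δ ![k, y'] ∈ Ω :=
    meshDomain_subset_meshVertices _ _ (DiscreteDobrushin.zdBoundary_subset_meshDomain _ huB)
  have hvΩ : meshPoint δ ![k + 1, y'] ∈ Ω :=
    meshDomain_subset_meshVertices _ _ (DiscreteDobrushin.zdBoundary_subset_meshDomain _ hvB)
  have hcΩ : c ∉ Ω := (hΩ.frontier_eq ▸ hc_fr).2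
  obtain ⟨hcre1, hcre2, hcim1, hcim2⟩ := hcl' c hcF'
  have hz₀seg : z₀ ∈ segment ℝ C Pstar := by
    refine ⟨2⁻¹, 2⁻¹, by norm_num, by norm_num, by norm_num, ?_⟩
    rw [hCeq, hPeq, hz₀]; apply Complex.ext <;> simp <;> ring
  -- every point of `X ∪ run` in `Ω` has `re = δ(k+½)` or lies in the open cell below
  have hre_or : ∀ z ∈ X ∪ segment ℝ C ztop, z ∈ Ω →
      (z.re = δ * k + δ / 2 ∧ δ * y' ≤ z.im) ∨ z ∈ cell δ k (y' - 1) ∨ δ * y' + δ * (3 / 2) ≤ z.im := by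
    rintro z (hz | hz) hzΩ
    · rcases hXΩmem z hz hzΩ with h | h
      · exact Or.inl ⟨by rw [(hsegP z h).1]; ring, (hsegP z h).2.1⟩
      · exact Or.inr (Or.inl h)
    · exact Or.inl ⟨by rw [(hrun z hz).1]; ring, by linarith [(hrun z hz).2.1]⟩
  -- m ≠ ztop
  have h_m_ne : C ≠ ztop := by
    intro h
    have := congrArg Complex.im h
    rw [hCeq, hztop, cellCenter_eq] at this
    simp only at this
    have : (y' : ℝ) = R := by have := mul_left_cancel₀ hδ.ne' this; linarith
    have : y' = R := by exact_mod_cast this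
    omega
  -- P ∩ run = {m}
  have h_inter : X ∩ segment ℝ C ztop = {C} := by
    ext z
    simp only [mem_inter_iff, mem_singleton_iff]
    constructor
    · rintro ⟨hzX, hzr⟩
      obtain ⟨hre, him1, -⟩ := hrun z hzr
      rcases hXsub hzX with h | h
      · obtain ⟨-, -, him3⟩ := hdown z h
        rw [hCeq]; exact Complex.ext hre (le_antisymm him3 him1)
      · obtain ⟨-, -, -, him3⟩ := hcl' z h
        exfalso; linarith
    · intro h; rw [h]; exact ⟨hXarc.left_mem, left_mem_segment _ _ _⟩
  -- run ⊆ Ω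
  have h_runΩ : segment ℝ C ztop ⊆ Ω := by
    exact vertical_run_subset (E := (⟨Ω, δ, ∅, ∅⟩ : DiscreteDobrushin)) hΩ hJE hext hunb hδ hy'R.le fun j h1 h2 => (hcol j h1 h2).1
  -- window
  have h_ball : X ∪ segment ℝ C ztop ⊆ ball a η := by
    rintro z (hz | hz)
    · rcases hXsub hz with h | h
      · obtain ⟨hre, him1, him2⟩ := hdown z h
        exact hwin z (by rw [hre]; linarith) (by rw [hre]; linarith) (by linarith) (by linarith [hwR1])
      · obtain ⟨h1, h2, h3, h4⟩ := hcl' z h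
        exact hwin z (by linarith) (by linarith) (by linarith) (by linarith [hwR2])
    · obtain ⟨hre, him1, him2⟩ := hrun z hz
      exact hwin z (by rw [hre]; linarith) (by rw [hre]; linarith) (by linarith) (by linarith)
  -- mesh points of boundary sites are off the leg
  have h_mesh : ∀ x ∈ (⟨Ω, δ, ∅, ∅⟩ : DiscreteDobrushin).zdBoundary, meshPoint δ x ∉ X ∪ segment ℝ C ztop := by
    intro x hx hmem
    have hxΩ : meshPoint δ x ∈ Ω := meshDomain_subset_meshVertices _ _ (DiscreteDobrushin.zdBoundary_subset_meshDomain _ hx)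
    rcases hmem with h | h
    · rcases hXΩmem _ h hxΩ with h' | h'
      · exact meshPoint_re_ne hδ k x (hsegP _ h').1 rfl
      · exact meshPoint_not_mem_cell hδ x k (y' - 1) h'
    · exact meshPoint_re_ne hδ k x (hrun _ h).1 rfl
  -- the cut edge is an edge of `Ω_δ`
  have h_edge : s(![k, y'], ![k + 1, y']) ∈ (discreteDomainGraph Ω δ).edgeSet := by
    have h := adj_bottom_of_inner hQ
    dsimp only at h
    exact (SimpleGraph.mem_edgeSet (discreteDomainGraph Ω δ)).2 h
  -- exactly one inner face at the cut edge
  have h_uniq : ∃! f, (⟨Ω, δ, ∅, ∅⟩ : DiscreteDobrushin).IsInnerFace f ∧ IsCorner ![k, y'] f ∧ IsCorner ![k + 1, y'] f := by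
    refine ⟨![k, y'], ⟨hQ, isCorner_vec_iff.2 (Or.inl rfl), isCorner_vec_iff.2 (Or.inr (Or.inl rfl))⟩, ?_⟩
    rintro f ⟨hf, h1, h2⟩
    rcases face_eq_of_isCorner_h h1 h2 with h | h
    · exact h
    · rw [h] at hf; exact absurd hf hQ'
  -- pstar is the midpoint of the cut edge
  have h_pstar_eq : Pstar = (2⁻¹ : ℝ) • (meshPoint δ ![k, y'] + meshPoint δ ![k + 1, y']) := by
    rw [hPeq, hueq, hveq]; apply Complex.ext
    · simp only [add_re, Complex.real_smul, mul_re, ofReal_re, ofReal_im, zero_mul, sub_zero]; ring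
    · simp only [add_im, Complex.real_smul, mul_im, ofReal_re, ofReal_im, zero_mul, add_zero]; ring
  -- P ⊆ closedBall c (5δ)
  have h_closedBall : X ⊆ closedBall c (5 * δ) := by
    intro z hz
    rw [mem_closedBall]
    rcases hXsub hz with h | h
    · obtain ⟨hre, him1, him2⟩ := hdown z h
      refine (dist_le_of_abs_le (a := δ) (b := 2 * δ) (abs_le.2 ⟨by linarith, by linarith⟩)
        (abs_le.2 ⟨by linarith, by linarith⟩)).trans (by linarith)
    · obtain ⟨h1, h2, h3, h4⟩ := hcl' z h
      refine (dist_le_of_abs_le (a := δ) (b := δ) (abs_le.2 ⟨by linarith, by linarith⟩)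
        (abs_le.2 ⟨by linarith, by linarith⟩)).trans (by linarith)
  -- dist u c
  have h_du : dist (meshPoint δ ![k, y']) c ≤ 5 * δ := by
    rw [hueq]
    refine (dist_le_of_abs_le (a := δ) (b := δ) (abs_le.2 ⟨by simp only; linarith, by simp only; linarith⟩)
      (abs_le.2 ⟨by simp only; linarith, by simp only; linarith⟩)).trans (by linarith)
  -- dist v c
  have h_dv : dist (meshPoint δ ![k + 1, y']) c ≤ 5 * δ := by
    rw [hveq]
    refine (dist_le_of_abs_le (a := δ) (b := δ) (abs_le.2 ⟨by simp only; linarith, by simp only; linarith⟩)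
      (abs_le.2 ⟨by simp only; linarith, by simp only; linarith⟩)).trans (by linarith)
  -- closed `Ω_δ`-edges between boundary sites meet the leg only in `pstar`
  have h_edges : ∀ x ∈ (⟨Ω, δ, ∅, ∅⟩ : DiscreteDobrushin).zdBoundary, ∀ y ∈ (⟨Ω, δ, ∅, ∅⟩ : DiscreteDobrushin).zdBoundary, (discreteDomainGraph Ω δ).Adj x y → (X ∪ segment ℝ C ztop) ∩ segment ℝ (meshPoint δ x) (meshPoint δ y) ⊆ {Pstar} := by
    intro x hx y hy hxy z hz
    obtain ⟨hz1, hz2⟩ := hz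
    rw [mem_singleton_iff]
    have hxy' : (zdGraph 2).Adj x y := meshGraph_le_zdGraph _ _ (discreteDomainGraph_le_meshGraph _ _ hxy)
    have hzg : z ∈ gridLines δ := segment_meshPoint_subset_gridLines δ hxy' hz2
    have hxΩ : meshPoint δ x ∈ Ω := meshDomain_subset_meshVertices _ _ (DiscreteDobrushin.zdBoundary_subset_meshDomain _ hx)
    have hyΩ : meshPoint δ y ∈ Ω := meshDomain_subset_meshVertices _ _ (DiscreteDobrushin.zdBoundary_subset_meshDomain _ hy)
    rcases hz1 with hz1 | hz1
    · by_cases hzΩ : z ∈ Ω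
      · rcases hXΩmem z hz1 hzΩ with h | h
        · exact eq_midpoint_of_mem_segment_of_mem_gridLines hδ hadj (hsegP_sub h) hzg
        · exact absurd hzg (cell_subset_compl_gridLines hδ k (y' - 1) h)
      · have hzc : z = c := by
          by_contra hne; exact hzΩ (hXΩ ⟨hz1, hne⟩)
        rcases hc_cases with h | h | ⟨x', hx'⟩
        · rw [hzc, h]
        · rw [hzc] at hzg; exact absurd hzg (cell_subset_compl_gridLines hδ k (y' - 1) h)
        · exfalso
          rw [hzc, hx'] at hz2
          refine hcΩ (hx' ▸ ?_)
          rcases eq_or_eq_of_meshPoint_mem_segment hδ hxy' hz2 with h' | h'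
          · rw [h']; exact hxΩ
          · rw [h']; exact hyΩ
    · obtain ⟨n, hn1, hn2, hzn⟩ := exists_eq_of_mem_vertical_run_of_mem_gridLines hδ hy'R.le hz1 hzg
      exfalso
      rw [hzn] at hz2
      have hs := sym2_eq_of_midpoint_mem_segment_h hδ hxy' hz2
      have hmem : ∀ w : Site 2, w ∈ s(x, y) → w ∈ (⟨Ω, δ, ∅, ∅⟩ : DiscreteDobrushin).zdBoundary := fun w hw => by
        rcases Sym2.mem_iff.1 hw with h' | h'
        · rw [h']; exact hx
        · rw [h']; exact hy
      have h1 : (![k, n] : Site 2) ∈ (⟨Ω, δ, ∅, ∅⟩ : DiscreteDobrushin).zdBoundary := hmem _ (by rw [hs]; exact Sym2.mem_mk_left _ _)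
      have h2 : (![k + 1, n] : Site 2) ∈ (⟨Ω, δ, ∅, ∅⟩ : DiscreteDobrushin).zdBoundary := hmem _ (by rw [hs]; exact Sym2.mem_mk_right _ _)
      have := (hcol (n - 1) (by omega) (by omega)).2
      rw [show n - 1 + 1 = n by ring] at this
      exact this ⟨h1, h2⟩
  -- the local picture at the cut edge (`…ExistsLegLocal`)
  have h_ballΩ : ball z₀ (δ / 8) ⊆ Ω := sectorBall_subset hδ (X₀ := δ * k) (Y₀ := δ * y') rfl rfl hfull
  have h_sector := inter_sectorBall_subset (L := X ∪ segment ℝ C ztop) hδ (X₀ := δ * k) (Y₀ := δ * y')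
    rfl rfl hfull hueq hveq hre_or
  have h_acc_u := access_u_local (L := X ∪ segment ℝ C ztop) hδ (X₀ := δ * k) (Y₀ := δ * y')
    rfl rfl hfull hueq hveq huΩ hre_or
  have h_acc_v := access_v_local (L := X ∪ segment ℝ C ztop) hδ (X₀ := δ * k) (Y₀ := δ * y')
    rfl rfl hfull hueq hveq hvΩ hre_or
  have h_box_v := box_v_local (L := X ∪ segment ℝ C ztop) hδ (X₀ := δ * k) (Y₀ := δ * y') rfl hveq hre_or
  have h_box_u := box_u_local (L := X ∪ segment ℝ C ztop) hδ (X₀ := δ * k) (Y₀ := δ * y') rfl hueq hre_or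
  exact ⟨⟨c, C, ztop, Pstar, z₀, δ / 8, ![k, y'], ![k + 1, y'], 0, X, (vec_add_cornerUnit_zero k y').symm,
    hXarc, h_m_ne, h_inter, hc_fr, hXΩ, h_runΩ, h_ball, hp, h_mesh, huB, hvB, h_edge, h_uniq,
    hsegX (right_mem_segment _ _ _), h_pstar_eq, h_closedBall, h_du, h_dv, h_edges, hsegX hz₀seg,
    by positivity, by linarith, h_ballΩ, h_sector, h_acc_u, h_acc_v, h_box_v, h_box_u, ⟨hnd.2, hnd.1⟩⟩⟩

end Summit.CriticalPhenomena.CardyFormulaZ2.Theorems.DiscretisationFamilyExists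

end
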